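import Summits.HodgeConjecture.HodgeConjecture.Theses.NikulinTwinTransport
import Summits.HodgeConjecture.HodgeConjecture.Theorems.NikulinTwinTransportTwinSimilitudeAlgebraic
import Summits.HodgeConjecture.HodgeConjecture.Theorems.NikulinTwinTransportTwinSimilitudeAlgebraicMarkings
import Summits.HodgeConjecture.HodgeConjecture.Theorems.NikulinTwinTransportSquareTranscendental
import Literature.AlgebraicGeometry.Surfaces.K3Marking
import Literature.AlgebraicGeometry.Surfaces.K3HodgeTypesHolds
import Literature.AlgebraicGeometry.HodgeTheory.HodgeIndexSurface
import Literature.AlgebraicGeometry.HodgeTheory.ComplexGysinCorrespondence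
import HarnessLib

/-!
# Route NikulinTwinTransport · crux `TwinSimilitudeAlgebraic` (stmt-HodgeConjecture-13674) —
# stub `stub_outAnchorOfSimilitude` of line `hyperkaehler-nikulin-anchors` (reshape r1)

**An algebraic rational Hodge `2`-similitude between projective K3 surfaces is an out-anchor.**
Let `S`, `Sg` be projective K3 surfaces with integral generators `p`, `pg` of `H⁴`, and let
`Ψ₀ : H²(S(ℂ); ℂ) → H²(Sg(ℂ); ℂ)` be `ℂ`-linear, rational, type-preserving, a `2`-similitude
(`(x.y) = c·p ⟹ (Ψ₀x.Ψ₀y) = 2c·pg`) and algebraic (the action of an algebraic class on `Sg ⊗ S`).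
Then `Ψ₀` underlies an OUT-ANCHOR at `S` with partner `Sg`: a `ℂ`-linear equivalence
`Ψ : H²(S) ≃ H²(Sg)`, algebraic (same class), whose inverse is rational, type-preserving and HALVES
the cup form.

Proof (`stub_outAnchorOfSimilitude`, the two-surface version of the second half of
`rmAnchor_at_of_realMultiplication_algebraic_at`): mark both surfaces
(`Huybrechts_K3_marking_exists`: `η : H²(S) ≅ Λ_ℂ`, cup product `= (η·.η·) p₀`, `p₀ = n p`; `η'`
for `Sg`). (i) `Ψ₀` is injective: every cup product on `S` is a multiple of `p`, so `Ψ₀ x = 0`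
makes `x` cup-orthogonal to everything (`pg ≠ 0`, `generator_ne_zero`), whence `x = 0` by the
non-degeneracy of the K3 form (`k3FormC_nondegenerate`); (ii) hence bijective, both `H²` being
`22`-dimensional through the markings; `Ψ := LinearEquiv.ofBijective Ψ₀`. (iii) `Ψ⁻¹` is rational:
read through the markings `Ψ₀` is the complexification of an injective, hence bijective,
`ℚ`-linear endomorphism `τ` of `Λ_ℚ` (`markingConj_intCast`, `exists_ratEnd_of_forall_intCast`,
`isRationalClass_iff_of_marking`). (iv) `Ψ⁻¹` is type-preserving: with `σ = η⁻¹x₀`, `σ' = η'⁻¹x₀'`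
the `(2,0)`-classes, `Ψ₀σ = t₁σ'`, `Ψ₀σ̄ = t₂σ̄'` with `t₁, t₂ ≠ 0` (types `(2,0)`, `(0,2)` are
lines, `Huybrechts_K3_hodgeTypes_H2_holds`; injectivity), so `Ψ⁻¹` preserves the two lines, and it
preserves `H^{1,1} = ⟨σ, σ̄⟩^⊥` because `Ψ₀x.Ψ₀y = 0 ⟹ x.y = 0`; the types `(i, j)` with `i + j ≠ 2`
carry only `0` (`isOfHodgeType_eq_zero_of_add_ne`). (v) `Ψ⁻¹` halves: `(u.v) = 2b·pg` and
`(Ψ⁻¹u.Ψ⁻¹v) = c·p` give `2c·pg = 2b·pg`, so `c = b`. The algebraicity clause passes through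
(`Ψ x = Ψ₀ x` definitionally).

Hypotheses (all in the registered signature): `Huybrechts_K3_marking_exists`. Prover seat
prover-line-stmt-HodgeConjecture-13674-0.

## References

* [Huybrechts2016K3] D. Huybrechts, Lectures on K3 Surfaces, CUP 2016, Ch. 1 Prop. 3.5, Ch. 3 §2,
  Ch. 6 Prop. 1.2, Ch. 14 §0.3 (vi).
* [Buskin2019] N. Buskin, J. reine angew. Math. 755 (2019), §6.2 (markings, proof of Thm. 1.1).
* [Varesco2023] M. Varesco, Math. Z. 305 (2023), §2, Rem. 2.2.
-/

noncomputable section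

set_option linter.dupNamespace false

open CategoryTheory MonoidalCategory
open scoped Manifold Matrix
open Literature.AlgebraicGeometry.Motives Literature.AlgebraicGeometry.HodgeTheory
open Literature.AlgebraicGeometry.Surfaces Literature.Geometry.Kaehler
open Literature.AlgebraicTopology.SingularHomology
open Summit.HodgeConjecture.HodgeConjecture.Theses.NikulinTwinTransport

namespace Summit.HodgeConjecture.HodgeConjecture.Theorems.NikulinTwinTransport

/-! ## Local notations — VERBATIM those of the registered skeleton
`Cruxes/TwinSimilitudeAlgebraic/Lines/hyperkaehler_nikulin_anchors.lean` -/

/-- `Gen[S, p]`: `p` is an integral generator of `H⁴(S(ℂ); ℂ)` (the generator clause of X). Local notation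
only. -/
local notation3 (prettyPrint := false) "Gen[" S ", " p "]" =>
  (IsIntegralClass p ∧ ∀ q : complexBetti S (2 * 2), IsIntegralClass q → ∃ n : ℤ, q = n • p)

/-- `Corr[μ, S, S', hS, hS' ; γ, y] = [γ]_* y = fst_*(snd^* y ∪ γ)`, the action of
`γ ∈ H⁴((S ⊗ S′)(ℂ); ℂ)` as a correspondence `H²(S′) → H²(S)` (the FIRST factor receives). Local notation
only, verbatim from the route's Theorems files; for `hS hS'` the K3 witnesses it is definitionally the
inline term of the route items. -/
local notation3 (prettyPrint := false) "Corr[" μ ", " S ", " S' ", " hS ", " hS' " ; " γ ", " y "]" =>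
  complexGysin μ
    (IsSmoothProjective.tensor_holds (IsK3Surface.isSmoothProjective hS)
      (IsK3Surface.isSmoothProjective hS'))
    (IsK3Surface.isSmoothProjective hS) (SemiCartesianMonoidalCategory.fst S S')
    (rfl : 2 * 1 + 2 * 2 + 2 * 2 = 2 * 1 + 2 * (2 + 2))
    (cupProduct (rfl : 2 * 1 + 2 * 2 = 2 * 1 + 2 * 2)
      (complexBetti.map (SemiCartesianMonoidalCategory.snd S S') (2 * 1) y) γ)

/-- `OutAnchor[μ, S, Sg, hS, hSg, p, pg]`: AN ALGEBRAIC OUT-ANCHOR `2`-SIMILITUDE AT `S` WITH PARTNER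
`Sg` — a `ℂ`-linear equivalence `Ψ : H²(S) ≃ H²(Sg)` which is algebraic (the action of an algebraic
class on `Sg ⊗ S`) and whose inverse is rational, type-preserving and HALVES the cup form
(`(u.v) = 2b·pg ⟹ (Ψ⁻¹u.Ψ⁻¹v) = b·p`).  Symbol for symbol the body of `AnchorData[μ, Sg, hSg, pg]`
(= the body of the route crux `TwinTwistorTransport` at `Sg`) with the partner `S″ := S`, `p″ := p`.
Local notation only. -/
local notation3 (prettyPrint := false)
    "OutAnchor[" μ ", " S ", " Sg ", " hS ", " hSg ", " p ", " pg "]" =>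
  ∃ Ψ : complexBetti S (2 * 1) ≃ₗ[ℂ] complexBetti Sg (2 * 1),
    (∀ y, IsRationalClass y → IsRationalClass (Ψ.symm y)) ∧
    (∀ (i j : ℕ) y, IsOfHodgeType 2 Sg (2 * 1) i j y →
      IsOfHodgeType 2 S (2 * 1) i j (Ψ.symm y)) ∧
    (∀ (u v : complexBetti Sg (2 * 1)) (b : ℂ),
      cupProduct (rfl : 2 * 1 + 2 * 1 = 2 * 2) u v = ((2 : ℂ) * b) • pg →
        cupProduct (rfl : 2 * 1 + 2 * 1 = 2 * 2) (Ψ.symm u) (Ψ.symm v) = b • p) ∧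
    ∃ γ ∈ algebraicClasses (MonoidalCategoryStruct.tensorObj Sg S) 2,
      ∀ x : complexBetti S (2 * 1), Ψ x = Corr[μ, Sg, S, hSg, hS ; γ, x]

/-! ## The stub -/

/-- **An algebraic rational Hodge `2`-similitude `Ψ₀ : H²(S) → H²(Sg)` between projective K3
surfaces is an out-anchor at `S` with partner `Sg`** (registered stub `stub_outAnchorOfSimilitude`
of line `hyperkaehler-nikulin-anchors`): `Ψ₀` is injective (a `2`-similitude of the non-degenerate
cup form, `pg ≠ 0`), hence a `ℂ`-linear equivalence `Ψ` (both `H²` are `22`-dimensional through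
markings); `Ψ⁻¹` is rational (through the markings `Ψ₀` is the complexification of a bijective
`ℚ`-linear endomorphism of `Λ_ℚ`), type-preserving (`Ψ₀` carries the lines `H^{2,0} = ℂσ`,
`H^{0,2} = ℂσ̄` of `S` onto those of `Sg` by non-zero scalars, and `H^{1,1} = ⟨σ, σ̄⟩^⊥` is
preserved since `Ψ₀x.Ψ₀y = 0 ⟹ x.y = 0`) and halves cup products; algebraicity passes through
(`Ψ x = Ψ₀ x`). [cite: Huybrechts2016K3, Ch. 6 Prop. 1.2 and Ch. 1 Prop. 3.5]
[cite: Buskin2019, §6.2, proof of Thm. 1.1] [cite: Varesco2023, §2 and Rem. 2.2] -/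
theorem stub_outAnchorOfSimilitude :
    Huybrechts_K3_marking_exists →
    ∀ (μ : OrientationFamily), μ.HasPoincareDuality →
      ∀ (S Sg : SchemeOver ℂ) (hS : IsK3Surface S) (hSg : IsK3Surface Sg)
        (p : complexBetti S (2 * 2)) (pg : complexBetti Sg (2 * 2)), Gen[S, p] → Gen[Sg, pg] →
        ∀ (Ψ₀ : complexBetti S (2 * 1) →ₗ[ℂ] complexBetti Sg (2 * 1)),
          (∀ x, IsRationalClass x → IsRationalClass (Ψ₀ x)) →
          (∀ (i j : ℕ) x, IsOfHodgeType 2 S (2 * 1) i j x →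
            IsOfHodgeType 2 Sg (2 * 1) i j (Ψ₀ x)) →
          (∀ (x y : complexBetti S (2 * 1)) (c : ℂ),
            cupProduct (rfl : 2 * 1 + 2 * 1 = 2 * 2) x y = c • p →
              cupProduct (rfl : 2 * 1 + 2 * 1 = 2 * 2) (Ψ₀ x) (Ψ₀ y) = ((2 : ℂ) * c) • pg) →
          (∃ γ ∈ algebraicClasses (MonoidalCategoryStruct.tensorObj Sg S) 2,
            ∀ x : complexBetti S (2 * 1), Ψ₀ x = Corr[μ, Sg, S, hSg, hS ; γ, x]) →
          OutAnchor[μ, S, Sg, hS, hSg, p, pg] := by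
  intro hmark μ _ S Sg hS hSg p pg hp hpg Ψ₀ hr ht hs halg
  -- markings of `S` and of `Sg`
  obtain ⟨η, p₀, x₀, hp₀, ⟨hp₀int, -, hηint, hηcup, h20, -⟩, ⟨-, hxpos, -⟩⟩ := hmark S hS
  obtain ⟨η', p₀', x₀', -, ⟨-, -, hη'int, -, h20', -⟩, ⟨-, hx'pos, -⟩⟩ := hmark Sg hSg
  clear p₀'
  -- `p₀ = n p`, `pg ≠ 0`; every cup product on `S` is a multiple of `p`
  obtain ⟨n, hn⟩ := hp.2 p₀ hp₀int
  rw [← Int.cast_smul_eq_zsmul ℂ] at hn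
  have hpg0 : pg ≠ 0 := generator_ne_zero hSg hpg.2
  have hcp : ∀ x y : complexBetti S (2 * 1),
      cupProduct (rfl : 2 * 1 + 2 * 1 = 2 * 2) x y = (k3Form (η x) (η y) * (n : ℂ)) • p := by
    intro x y
    rw [hηcup, hn, smul_smul]
  -- the similitude identity and its consequence `Ψ₀x.Ψ₀y = 0 ⟹ x.y = 0`
  have hΨ2 : ∀ x y : complexBetti S (2 * 1),
      cupProduct (rfl : 2 * 1 + 2 * 1 = 2 * 2) (Ψ₀ x) (Ψ₀ y) =
        ((2 : ℂ) * (k3Form (η x) (η y) * (n : ℂ))) • pg := fun x y => hs x y _ (hcp x y)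
  have hzero : ∀ x y : complexBetti S (2 * 1),
      cupProduct (rfl : 2 * 1 + 2 * 1 = 2 * 2) (Ψ₀ x) (Ψ₀ y) = 0 →
        cupProduct (rfl : 2 * 1 + 2 * 1 = 2 * 2) x y = 0 := by
    intro x y h
    rw [hΨ2] at h
    rw [hcp, (mul_eq_zero.1 ((smul_eq_zero.1 h).resolve_right hpg0)).resolve_left two_ne_zero,
      zero_smul]
  -- `Ψ₀` is injective: a `2`-similitude of the non-degenerate cup form
  have hinj : Function.Injective Ψ₀ := by
    refine (injective_iff_map_eq_zero _).2 fun x hx => ?_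
    have hx0 : ∀ y, k3Form (η x) (η y) = 0 := fun y => by
      have h := hzero x y (by rw [hx, map_zero, LinearMap.zero_apply])
      rw [hηcup, smul_eq_zero] at h
      exact h.resolve_right hp₀
    have hηx : η x = 0 := k3FormC_nondegenerate.1 (η x) fun w => by
      rw [k3FormC_apply, ← η.apply_symm_apply w]
      exact hx0 _
    simpa using congrArg η.symm hηx
  -- hence bijective: both `H²` are `22`-dimensional through the markings
  haveI : FiniteDimensional ℂ (complexBetti S (2 * 1)) := LinearEquiv.finiteDimensional η.symm
  haveI : FiniteDimensional ℂ (complexBetti Sg (2 * 1)) := LinearEquiv.finiteDimensional η'.symm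
  have hsurj : Function.Surjective Ψ₀ :=
    (LinearMap.injective_iff_surjective_of_finrank_eq_finrank
      (η.finrank_eq.trans η'.finrank_eq.symm)).1 hinj
  set Ψ : complexBetti S (2 * 1) ≃ₗ[ℂ] complexBetti Sg (2 * 1) :=
    LinearEquiv.ofBijective Ψ₀ ⟨hinj, hsurj⟩ with hΨdef
  have hΨ : ∀ x, Ψ x = Ψ₀ x := fun x => rfl
  have hΨsymm : ∀ y, Ψ₀ (Ψ.symm y) = y := fun y => by rw [← hΨ, LinearEquiv.apply_symm_apply]
  -- `η' ∘ Ψ₀ ∘ η⁻¹` is the complexification of a bijective `ℚ`-linear `τ`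
  obtain ⟨τ, hτ⟩ :=
    exists_ratEnd_of_forall_intCast _ (markingConj_intCast hSg η' hη'int η hηint Ψ₀ hr)
  have hτ' : ∀ u : K3Index → ℚ,
      η' (Ψ₀ (η.symm fun i => (u i : ℂ))) = fun i => (τ u i : ℂ) := fun u => by
    simpa only [LinearMap.coe_comp, LinearEquiv.coe_coe, Function.comp_apply] using hτ u
  have hτinj : Function.Injective τ := by
    refine (injective_iff_map_eq_zero _).2 fun u hu => ?_
    have h := hτ' u
    rw [hu] at h
    have h0 : η' (Ψ₀ (η.symm fun i => (u i : ℂ))) = 0 := by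
      rw [h]
      funext i
      simp only [Pi.zero_apply, Rat.cast_zero]
    rw [LinearEquiv.map_eq_zero_iff, ← LinearMap.mem_ker, LinearMap.ker_eq_bot.2 hinj,
      Submodule.mem_bot, LinearEquiv.map_eq_zero_iff] at h0
    funext i
    have hi := congrFun h0 i
    simpa using hi
  have hτsurj : Function.Surjective τ := LinearMap.injective_iff_surjective.1 hτinj
  -- the `(2,0)`-classes `σ = η⁻¹ x₀`, `σ' = η'⁻¹ x₀'` and the Hodge types of `S`, `Sg`
  have hσ0 : η.symm x₀ ≠ 0 := fun h0 =>
    ne_zero_of_star_self_re_pos hxpos (by simpa using congrArg η h0)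
  have hσ'0 : η'.symm x₀' ≠ 0 := fun h0 =>
    ne_zero_of_star_self_re_pos hx'pos (by simpa using congrArg η' h0)
  have hstar0 : η.symm (star x₀) ≠ 0 := fun h0 => by
    apply hσ0
    have : star x₀ = 0 := by simpa using congrArg η h0
    rw [show x₀ = star (star x₀) from (star_star x₀).symm, this, star_zero, map_zero]
  obtain ⟨h1, h2, h3⟩ := Huybrechts_K3_hodgeTypes_H2_holds S hS (η.symm x₀) h20 hσ0
  obtain ⟨h1', h2', h3'⟩ := Huybrechts_K3_hodgeTypes_H2_holds Sg hSg (η'.symm x₀') h20' hσ'0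
  rw [conjClass_marking_symm η hηint] at h2 h3
  rw [conjClass_marking_symm η' hη'int] at h2' h3'
  -- `Ψ₀ σ = t₁ σ'`, `Ψ₀ σ̄ = t₂ σ̄'` with `t₁, t₂ ≠ 0`
  obtain ⟨t₁, ht₁⟩ := (h1' _).1 (ht 2 0 _ h20)
  obtain ⟨t₂, ht₂⟩ := (h2' _).1 (ht 0 2 _ ((h2 _).2 ⟨1, (one_smul ℂ _).symm⟩))
  have ht₁0 : t₁ ≠ 0 := by
    rintro rfl
    exact hσ0 (hinj (by rw [ht₁, zero_smul, map_zero]))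
  have ht₂0 : t₂ ≠ 0 := by
    rintro rfl
    exact hstar0 (hinj (by rw [ht₂, zero_smul, map_zero]))
  have hσinv : Ψ.symm (η'.symm x₀') = t₁⁻¹ • η.symm x₀ := by
    rw [LinearEquiv.symm_apply_eq, map_smul, hΨ, ht₁, smul_smul, inv_mul_cancel₀ ht₁0, one_smul]
  have hσ'inv : Ψ.symm (η'.symm (star x₀')) = t₂⁻¹ • η.symm (star x₀) := by
    rw [LinearEquiv.symm_apply_eq, map_smul, hΨ, ht₂, smul_smul, inv_mul_cancel₀ ht₂0, one_smul]
  refine ⟨Ψ, ?_, ?_, ?_, ?_⟩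
  · -- the inverse is rational
    intro y hy
    obtain ⟨w, hw⟩ := (isRationalClass_iff_of_marking hSg η' hη'int y).1 hy
    obtain ⟨u, rfl⟩ := hτsurj w
    have hy' : Ψ₀ (η.symm fun i => (u i : ℂ)) = y := by
      apply η'.injective
      rw [hw, hτ' u]
    have : Ψ.symm y = η.symm fun i => (u i : ℂ) := by
      rw [LinearEquiv.symm_apply_eq, hΨ, hy']
    rw [this]
    exact (isRationalClass_iff_of_marking hS η hηint _).2 ⟨u, by rw [LinearEquiv.apply_symm_apply]⟩
  · -- the inverse preserves the Hodge types
    intro i j y hy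
    by_cases hij : i + j = 2 * 1
    · obtain ⟨rfl, rfl⟩ | ⟨rfl, rfl⟩ | ⟨rfl, rfl⟩ :
          (i = 2 ∧ j = 0) ∨ (i = 0 ∧ j = 2) ∨ (i = 1 ∧ j = 1) := by omega
      · obtain ⟨t, rfl⟩ := (h1' y).1 hy
        exact (h1 _).2 ⟨t * t₁⁻¹, by rw [map_smul, hσinv, smul_smul]⟩
      · obtain ⟨t, rfl⟩ := (h2' y).1 hy
        exact (h2 _).2 ⟨t * t₂⁻¹, by rw [map_smul, hσ'inv, smul_smul]⟩
      · obtain ⟨hy1, hy2⟩ := (h3' y).1 hy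
        refine (h3 _).2 ⟨?_, ?_⟩
        · refine hzero _ _ ?_
          rw [hΨsymm, ht₁, map_smul, hy1, smul_zero]
        · refine hzero _ _ ?_
          rw [hΨsymm, ht₂, map_smul, hy2, smul_zero]
    · obtain rfl := isOfHodgeType_eq_zero_of_add_ne hy hij
      rw [map_zero]
      obtain ⟨A⟩ := hS.nonempty_hodgeModel
      exact IsOfHodgeType.zero A _ _ _
  · -- the inverse halves cup products
    intro u v b huv
    have h := hΨ2 (Ψ.symm u) (Ψ.symm v)
    rw [hΨsymm, hΨsymm, huv] at h
    have hb : (2 : ℂ) * b = 2 * (k3Form (η (Ψ.symm u)) (η (Ψ.symm v)) * (n : ℂ)) :=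
      smul_left_injective ℂ hpg0 h
    rw [hcp, ← mul_left_cancel₀ (two_ne_zero' ℂ) hb]
  · -- `Ψ = Ψ₀` is algebraic
    obtain ⟨γ, hγ, hΨ₀γ⟩ := halg
    exact ⟨γ, hγ, fun x => (hΨ x).trans (hΨ₀γ x)⟩

end Summit.HodgeConjecture.HodgeConjecture.Theorems.NikulinTwinTransport

end
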